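import Literature.Analysis.FluidPDE.NSBoundedMildOseenDuhamel
import HarnessLib

/-!
# The far/near splitting of the Oseen Duhamel term

Analysis/FluidPDE support file (everything proved) on the discharge path of the named fact
`Literature.Analysis.FluidPDE.knss2009_local_smoothing` (`NSBoundedMildSmoothing.lean`;
Koch–Nadirashvili–Seregin–Šverák 2009, Prop. 4.1: smoothing of bounded mild solutions). The
bilinear Duhamel term `B^ν_s(v,w)(t)(x) = ∫_{(s,t)} ∫ K(ν(t-τ), x-y)[v(τ,y), w(τ,y)] dy dτ`
(`oseenDuhamel`) of bounded measurable fields is split at an intermediate time `t₁ ∈ (s, t)`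
into

* the **far part** `∫_{(s,t₁)} ∫ K(ν(t-τ), x-y)[v(τ,y), w(τ,y)] dy dτ`, in which the kernel time
  `ν(t-τ) ≥ ν(t-t₁)` stays away from `0` (so that all space-time derivatives may be put on the
  kernel), and
* the **near part**, rewritten by the substitutions `τ = t₁ + θ(t-t₁)` (`θ ∈ (0,1)`) and
  `y = x - u` as `(t-t₁) ∫_{(0,1)} ∫ K(ν(1-θ)(t-t₁), u)[v(t₁+θ(t-t₁), x-u), w(t₁+θ(t-t₁), x-u)] du dθ`,
  an integral over the *fixed* domain `(0,1) × E` in which the space variable and the time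
  variable enter only through the (smooth, for `τ > t₁ > s`) fields

(`oseenDuhamel_eq_far_add_near`). This is the form in which the joint smoothness of `B(v,w)` in
`(t, x)` and the weighted derivative bounds of KNSS 2009, Prop. 4.1 ("the key is the estimate of
`B` in the weighted spaces") are proved by differentiation under the integral sign.

## References

* G. Koch, N. Nadirashvili, G. Seregin, V. Šverák, Acta Math. 203 (2009) = arXiv:0709.3599, §4
  p. 8, (4.3)–(4.5) and Prop. 4.1. [KochNadirashviliSereginSverak2009]
-/

noncomputable section

open MeasureTheory Set Function Filter intervalIntegral
open scoped RealInnerProductSpace NNReal ENNReal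

namespace Literature.Analysis.FluidPDE

variable {E : Type*} [NormedAddCommGroup E] [InnerProductSpace ℝ E] [FiniteDimensional ℝ E]
  [MeasurableSpace E] [BorelSpace E]

variable {ν s T M : ℝ} {v w : ℝ → E → E}

/-- **The time slices of the Duhamel integrand are integrable in time**: for bounded measurable
fields on `(s, T) × E`, `ν > 0`, `s < t ≤ T`, the function
`τ ↦ ∫ K(ν(t-τ), x-y)[v(τ,y), w(τ,y)] dy` is integrable on `(s, t)` (Fubini under the absolute
convergence `integrable_oseenKernel_duhamel_bounded`). [folklore] -/
theorem integrableOn_integral_oseenKernel_duhamel (hν : 0 < ν)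
    (hv : AEStronglyMeasurable (uncurry v) ((volume : Measure (ℝ × E)).restrict (Ioo s T ×ˢ univ)))
    (hw : AEStronglyMeasurable (uncurry w) ((volume : Measure (ℝ × E)).restrict (Ioo s T ×ˢ univ)))
    (hM : 0 ≤ M) (hvM : ∀ τ ∈ Ioo s T, ∀ y, ‖v τ y‖ ≤ M) (hwM : ∀ τ ∈ Ioo s T, ∀ y, ‖w τ y‖ ≤ M)
    {t : ℝ} (hst : s < t) (htT : t ≤ T) (x : E) :
    IntegrableOn (fun τ => ∫ y, oseenKernel (ν * (t - τ)) (x - y) (v τ y) (w τ y)) (Ioo s t) := by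
  have hint := integrable_oseenKernel_duhamel_bounded hν hv hw hM hvM hwM hst htT x
  rw [volume_restrict_prod_univ_eq_prod] at hint
  exact hint.integral_prod_left

/-- **The far part as an iterated integral equals the product integral** over `(s, t₁) × E`
(Fubini; the integrand with kernel time `ν(t-τ)`, `τ < t₁ ≤ t`). [folklore] -/
theorem setIntegral_integral_oseenKernel_eq_integral_prod (hν : 0 < ν)
    (hv : AEStronglyMeasurable (uncurry v) ((volume : Measure (ℝ × E)).restrict (Ioo s T ×ˢ univ)))
    (hw : AEStronglyMeasurable (uncurry w) ((volume : Measure (ℝ × E)).restrict (Ioo s T ×ˢ univ)))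
    (hM : 0 ≤ M) (hvM : ∀ τ ∈ Ioo s T, ∀ y, ‖v τ y‖ ≤ M) (hwM : ∀ τ ∈ Ioo s T, ∀ y, ‖w τ y‖ ≤ M)
    {t₁ t : ℝ} (hst : s < t) (ht₁t : t₁ ≤ t) (htT : t ≤ T) (x : E) :
    ∫ τ in Ioo s t₁, ∫ y, oseenKernel (ν * (t - τ)) (x - y) (v τ y) (w τ y) =
      ∫ ω in Ioo s t₁ ×ˢ univ, oseenKernel (ν * (t - ω.1)) (x - ω.2) (v ω.1 ω.2) (w ω.1 ω.2)
        ∂(volume : Measure (ℝ × E)) := by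
  have hint := integrable_oseenKernel_duhamel_bounded hν hv hw hM hvM hwM hst htT x
  have hsub : Ioo s t₁ ×ˢ (univ : Set E) ⊆ Ioo s t ×ˢ univ :=
    prod_mono (Ioo_subset_Ioo_right ht₁t) subset_rfl
  have hint₁ := hint.mono_measure (Measure.restrict_mono hsub le_rfl)
  rw [volume_restrict_prod_univ_eq_prod] at hint₁ ⊢
  rw [integral_prod _ hint₁]

/-- **Far/near splitting of the Duhamel term**: for bounded measurable fields on `(s, T) × E`,
`ν > 0` and `s < t₁ < t ≤ T`,
`B^ν_s(v,w)(t)(x) = ∫_{(s,t₁)} ∫ K(ν(t-τ), x-y)[v(τ,y), w(τ,y)] dy dτ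
  + (t-t₁) ∫_{(0,1)} ∫ K(ν(1-θ)(t-t₁), u)[v(t₁+θ(t-t₁), x-u), w(t₁+θ(t-t₁), x-u)] du dθ`
(the substitutions `τ = t₁ + θ(t-t₁)` in time and `y = x - u` in space in the near part).
KNSS 2009, §4 (4.3): `B` as the object of the weighted estimates of Prop. 4.1.
[cite: KochNadirashviliSereginSverak2009, §4 (4.3)–(4.4) and Prop. 4.1 (arXiv:0709.3599 p. 8)] -/
theorem oseenDuhamel_eq_far_add_near (hν : 0 < ν)
    (hv : AEStronglyMeasurable (uncurry v) ((volume : Measure (ℝ × E)).restrict (Ioo s T ×ˢ univ)))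
    (hw : AEStronglyMeasurable (uncurry w) ((volume : Measure (ℝ × E)).restrict (Ioo s T ×ˢ univ)))
    (hM : 0 ≤ M) (hvM : ∀ τ ∈ Ioo s T, ∀ y, ‖v τ y‖ ≤ M) (hwM : ∀ τ ∈ Ioo s T, ∀ y, ‖w τ y‖ ≤ M)
    {t₁ t : ℝ} (hst₁ : s < t₁) (ht₁t : t₁ < t) (htT : t ≤ T) (x : E) :
    oseenDuhamel ν s v w t x =
      (∫ τ in Ioo s t₁, ∫ y, oseenKernel (ν * (t - τ)) (x - y) (v τ y) (w τ y)) +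
      (t - t₁) • ∫ θ in Ioo (0 : ℝ) 1, ∫ u, oseenKernel (ν * ((1 - θ) * (t - t₁))) u
        (v (t₁ + θ * (t - t₁)) (x - u)) (w (t₁ + θ * (t - t₁)) (x - u)) := by
  have hst : s < t := hst₁.trans ht₁t
  set G : ℝ → E := fun τ => ∫ y, oseenKernel (ν * (t - τ)) (x - y) (v τ y) (w τ y) with hG
  have hGint : IntegrableOn G (Ioo s t) :=
    integrableOn_integral_oseenKernel_duhamel hν hv hw hM hvM hwM hst htT x
  -- interval integrability on the two pieces
  have hI₁ : IntervalIntegrable G volume s t₁ := by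
    rw [intervalIntegrable_iff_integrableOn_Ioo_of_le hst₁.le]
    exact hGint.mono_set (Ioo_subset_Ioo_right ht₁t.le)
  have hI₂ : IntervalIntegrable G volume t₁ t := by
    rw [intervalIntegrable_iff_integrableOn_Ioo_of_le ht₁t.le]
    exact hGint.mono_set (Ioo_subset_Ioo_left hst₁.le)
  -- split the time integral at `t₁`
  have hsplit : oseenDuhamel ν s v w t x = (∫ τ in s..t₁, G τ) + ∫ τ in t₁..t, G τ := by
    rw [integral_add_adjacent_intervals hI₁ hI₂, integral_of_le hst.le, integral_Ioc_eq_integral_Ioo]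
    rfl
  rw [hsplit, integral_of_le hst₁.le, integral_Ioc_eq_integral_Ioo]
  congr 1
  -- the near part: `τ = t₁ + θ (t - t₁)`
  have hsubst := smul_integral_comp_mul_add (f := G) (a := 0) (b := 1) (t - t₁) t₁
  simp only [mul_zero, zero_add, mul_one, sub_add_cancel] at hsubst
  rw [← hsubst, integral_of_le zero_le_one, integral_Ioc_eq_integral_Ioo]
  congr 1
  refine setIntegral_congr_fun measurableSet_Ioo fun θ _ => ?_
  -- the inner integral: `y = x - u`
  simp only [hG]
  have h2 : (t - t₁) * θ + t₁ = t₁ + θ * (t - t₁) := by ring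
  have h1 : t - (t₁ + θ * (t - t₁)) = (1 - θ) * (t - t₁) := by ring
  simp only [h2]
  simp only [h1]
  rw [← integral_sub_left_eq_self (fun u => oseenKernel (ν * ((1 - θ) * (t - t₁))) u
    (v (t₁ + θ * (t - t₁)) (x - u)) (w (t₁ + θ * (t - t₁)) (x - u))) volume x]
  simp only [sub_sub_cancel]

end Literature.Analysis.FluidPDE

end
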